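import Literature.MathematicalPhysics.QuantumFieldTheory.Balaban1983to89.B9SectBGpTransferConvY
import Literature.MathematicalPhysics.QuantumFieldTheory.Balaban1983to89.B9SectBGpTransferInY
import Literature.MathematicalPhysics.QuantumFieldTheory.Balaban1983to89.B9SectBStepFamilyTransfer

/-!
# `Balaban1983to89.B9SectBCodedChainOnSubfamily` — the coded-carrier chain of Sect. B's step for `G′`, ON A SUBFAMILY OF MEMBERS
# CARRYING SECTIONS OF `β`, assembled: root frame, `hin`, `hout`, and the composed transfer to the record (NODE 00's letters)

T. Bałaban, *Propagators for lattice gauge theories in a background field*, Commun. Math. Phys. **99** (1985) 389–434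
[`Balaban1985BackgroundPropagators`, "B9"], Theorem 3.4 p. 400, Sect. B pp. 400–407, p. 403 l. 1–9 («of course with different constants»);
T. Bałaban, *Propagators and renormalization transformations for lattice gauge theories. II*, Commun. Math. Phys. **96** (1984) 223–250
[`Balaban1984PropagatorsII`, "[4]"], (2.1)–(2.4) p. 224, (2.45) p. 231, Lemma 2.1 p. 234.

statement-level skeleton of published theorems with citation tags; proofs where landed; nothing here is a claim about the Yang–Mills mass gap

WHY THIS FILE (pub-ymgap N06 row 13, seat dag-n06-c gen 8).  The family-level theorems of the coded-carrier chain —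
`B9SectBGpFrameCodedY.gpFrame₂Coded` (root frame), `B9SectBGpTransferInY.hin_KSC`, `B9SectBGpTransferConvY.hconv_KSC ∕ hout_KSC` — are typed over the FULL
member type `MemberY d ℓ hd hL b₀ b₁ Mstar` and carry the binder `hι : ∀ x s, β … (ιB x s) = s` (a section of `β` AT EVERY member).  That binder is
UNSATISFIABLE (`Node00.MemberYCornered.not_forall_memberY_beta_section`: cornered members exist for `k ≥ 3`), so those theorems are vacuous as typed, while
their content — the per-member theorems `thms_KSC_base_of_pullK`, `hconv_at`, the frame's field lemmas — is genuine at every member possessing a section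
(corner-free members, `Ω_k`-blocks all carriers; they exist: `B9SectBCodedClassY.exists_memberY_surjective_beta`).  THIS FILE RESTATES THE FAMILY LAYER ON AN
ARBITRARY SUBFAMILY `f : J → MemberY …` with sections `ιB j` of `β` at the members `f j` only (print's family p. 399 «(torus, k, {Ω_j}, M) for fixed d, L» read on
the sub-collection where the tree's carrier-block reading of (3.42) is print's), and COMPOSES the chain: §4 takes the Sect.-B step for the augmented coded readings
`KSC` on the subfamily (the frames' output) and returns the Sect.-B step FOR THE RECORD'S FAMILIES ON THE SUBFAMILY, under the displayed class implication
`hclass` (discharged for the class `C37Y` in `B9SectBCodedClassY`) and the analyticity transport `hAn` (the instance's pin).  §5 instantiates §1 and §4 on CORNER-FREE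
subfamilies (`β` onto at every `f j` — e.g. the subtype `{x // Function.Surjective (β x.hN x.D x.hk)}` with `f := Subtype.val`) with the canonical sections
`Function.surjInv`, where NO section binder remains.

WHAT IS IN THE FILE (0 sorry; standard axioms; two `def`s = the root frame on a subfamily ∕ on a corner-free subfamily, `GpFrame₂` records built from named
field lemmas).
* §1 `gpFrame₂CodedOn f` — `GpFrame₂` over `j ↦ (codingYx G (f j) (C37 j) (C38 j)).bg` (the construction of `gpFrame₂Coded`, member `x := f j`).
* §2 ★ `hin_KSC_on f` — the `hin` hypothesis of `B9SectBStepFamilyTransfer.sectBStepPrinted_of_family` on the subfamily.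
* §3 ★ `hconv_KSC_on f`, ★ `hout_KSC_on f` — the letter conversion and the `hout` hypothesis on the subfamily.
* §4 ★★ `sectBStepPrinted_on_of_KSC f` — THE COMPOSED TRANSFER: `SectBStepPrinted` for `(KSC, pullK GA, pullS Cinv)` over the coded carriers on `J` ⇒
  `SectBStepPrinted` for the record's `(G′ read by kernelFamilyS (GpY par) par, GA, Cinv)` over `bg9Y` on `J`, given `hclass` and `hAn`.
* §5 `surjInv_section`, `gpFrame₂CodedCornerFree`, ★★ `sectBStepPrinted_cornerFree_of_KSC` — §1 and §4 on a corner-free subfamily (`hf : ∀ j, Surjective β`),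
  sections `Function.surjInv (hf j)`, no `hι`.

HONEST SCOPE.  Bookkeeping over the landed per-member theorems; the two displayed hypotheses of §4∕§5 that are NOT discharged in the tree are (i) the
Sect.-B step for `KSC` over the coded carriers (the output of the letters-level frames; only the root frame §1 is inhabited so far) and (ii) `hAn`; the record
side's structural data (`hG1`, `par`, the basis `b`, nonnegative Hölder members `hGA`) are displayed.  Nothing of Theorem 3.1∕3.4 is asserted; N06 NOT
discharged; COUNT-NEUTRAL; one finite lattice programme — nothing continuum ∕ OS ∕ mass-gap ∕ Clay.  Cell `pub-ymgap` (HUMAN RULING D-0062), Track A node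
N06 [B9], row 13, 2026-08-28.

RELATED IN THE TREE, NOT DUPLICATED: the per-member theorems and the `MemberY`-level wrappers named above are USED ∕ MIRRORED BY NAME (the wrappers are the
instances `f := id` of §1–§3 and stay as they are); `B9SectBCodedCarrier.sectBStepPrinted_of_coded`, `B9SectBStepFamilyTransfer.sectBStepPrinted_of_family` USED.
-/

namespace Literature.MathematicalPhysics.QuantumFieldTheory.Balaban1983to89.B9SectBCodedChainOnSubfamily

open Literature.MathematicalPhysics.QuantumFieldTheory.Balaban1983to89
open Literature.MathematicalPhysics.QuantumFieldTheory.Balaban1983to89.B6KLevelCensusIndexV1 (KIdx kGeo)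
open Literature.MathematicalPhysics.QuantumFieldTheory.Balaban1983to89.B6Ineq2142KLevelV1 (β)
open Literature.MathematicalPhysics.QuantumFieldTheory.Balaban1983to89.B6RandomWalk (HasMajorant Ineq261)
open Literature.MathematicalPhysics.QuantumFieldTheory.Balaban1983to89.B9Thm34Ext (toB6)
open Literature.MathematicalPhysics.QuantumFieldTheory.Balaban1983to89.B9FromB6 (EBlock)
open Literature.MathematicalPhysics.QuantumFieldTheory.Balaban1983to89.B9Eq39Adjoint (fluct)
open Literature.MathematicalPhysics.QuantumFieldTheory.Balaban1983to89.B9Ineq385VG (kappa385 kappa385_nonneg)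
open Literature.MathematicalPhysics.QuantumFieldTheory.Balaban1983to89.B9SectBCodedCarrier (CCfg Coding pullK pullS pullAn sectBStepPrinted_of_coded)
open Literature.MathematicalPhysics.QuantumFieldTheory.Balaban1983to89.B9SectBStepFamilyTransfer (sectBStepPrinted_of_family)
open Literature.MathematicalPhysics.QuantumFieldTheory.Balaban1983to89.B9SectBGpStepAtLettersV2 (GpFrame₂)
open Literature.MathematicalPhysics.QuantumFieldTheory.Balaban1983to89.B9Eq360DeltaPrimeAY (AfldY mulY)
open Literature.MathematicalPhysics.QuantumFieldTheory.Balaban1983to89.B9PinMembersKLevelV1 (MemberY geo9Y bg9Y)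
open Literature.MathematicalPhysics.QuantumFieldTheory.Balaban1983to89.B9SectBGpLettersY
open Literature.MathematicalPhysics.QuantumFieldTheory.Balaban1983to89.B9SectBGpFrameCodedY (codingYx CplxLettersY Read342Y Write342Y exists_d261)
open Literature.MathematicalPhysics.QuantumFieldTheory.Balaban1983to89.B9SectBGpReadingsY (KSC)
open Literature.MathematicalPhysics.QuantumFieldTheory.Balaban1983to89.B9SectBGpTransferInY (thms_KSC_base_of_pullK)
open Literature.MathematicalPhysics.QuantumFieldTheory.Balaban1983to89.B9SectBGpTransferOutY (thms_pullK_prod_of_KSC)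
open Literature.MathematicalPhysics.QuantumFieldTheory.Balaban1983to89.B9SectBGpTransferConvY (hconv_at)
open Literature.MathematicalPhysics.QuantumFieldTheory.Balaban1983to89.B9RWSums347DefiniteFacesWindow (scaleTransfer6_window_geo9Y geo9Y_dist_nonneg)
open Literature.MathematicalPhysics.QuantumFieldTheory.Balaban1983to89.B9GeoLemma21KLevelV1 (geo9Y_dist_self geo9Y_dist_comm geo9Y_dist_triangle geo9Y_len_pos
  geo9K_eta_pos geo9K_one_le_L)
open Literature.MathematicalPhysics.QuantumFieldTheory.Balaban1983to89.B9GeoNbrCountKLevelV1 (exists_card_nbr_geo9Y_le_of_M)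
open Literature.MathematicalPhysics.QuantumFieldTheory.Balaban1983to89.Node00 (SiteY BlkY IBondY CfgY SiteParY shiftY deltaPrimeAY kernelFamilyS GpY)

variable {d ℓ : ℕ} {hd : 1 ≤ d + 1} {hL : Odd (ℓ + 1) ∧ 1 < ℓ + 1} {b₀ b₁ : ℝ} {Mstar : ℕ}
variable {𝔸 : Type} [NormedRing 𝔸] [NormedAlgebra ℂ 𝔸] [CompleteSpace 𝔸]

/-! ## §1 The root frame on a subfamily -/

section RootFrame

variable [NormOneClass 𝔸] {J : Type} (f : J → MemberY d ℓ hd hL b₀ b₁ Mstar)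
  (c35 : ℝ) (G : Subgroup 𝔸ˣ) {ι : Type} [Fintype ι] [DecidableEq ι] (b : Module.Basis ι ℝ 𝔸)
  [∀ x : MemberY d ℓ hd hL b₀ b₁ Mstar, Fintype (geo9Y x).Site] [instDS : ∀ x : MemberY d ℓ hd hL b₀ b₁ Mstar, DecidableEq (geo9Y x).Site]
  [∀ x : MemberY d ℓ hd hL b₀ b₁ Mstar, Nonempty (geo9Y x).Site]
  (C37 C38 : ∀ j : J, ℝ → CfgY 𝔸 (f j).toKIdx → AfldY 𝔸 (f j).toKIdx → Prop)
  (par : ∀ j : J, SiteParY 𝔸 (f j).toKIdx)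
  (ιB : ∀ j : J, BlkY (f j).toKIdx → IBondY (f j).toKIdx)
  (KC : ∀ j : J, B9.KernelFamily (geo9Y (f j)) (codingYx G (f j) (C37 j) (C38 j)).bg)

/-- ★ **THE ROOT SECT.-B FRAME `GpFrame₂` OVER THE CODED CARRIERS OF A SUBFAMILY `f : J → MemberY`** — the construction of
`B9SectBGpFrameCodedY.gpFrame₂Coded` at the members `x := f j`, the section binder `hι` asked AT THOSE MEMBERS ONLY; data, constants and field lemmas exactly
as there (NODE 00's letters `kQC sQC kFC sFC wC cfunC expAC ΔpC GopC LapC`, `a₀ = 1`, `d₀ = 2(d+1)`, `δcap = 1`, `Λf = L⁴`, n06-k's `(d261, M261)` and scale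
transfers; `hC37`, `hread`, `hwrite` displayed). [cite: Balaban1985BackgroundPropagators, Thm 3.4 p.400, (3.60) p.402, Thm 3.1 (3.42) p.397, (3.19) p.393, (3.35)–(3.37) p.396, p.399 (the family); Balaban1984PropagatorsII, Lemma 2.1 p.234, (2.51) p.232] -/
noncomputable def gpFrame₂CodedOn (hι : ∀ (j : J) (s : BlkY (f j).toKIdx), β (f j).toKIdx.hN (f j).toKIdx.D (f j).toKIdx.hk (ιB j s) = s)
    (hG1 : ∀ u : 𝔸ˣ, u ∈ G → ‖(u : 𝔸)‖ ≤ 1) (hpar : ∀ j (U : CfgY 𝔸 (f j).toKIdx), GVal G (f j).toKIdx U → ∀ z w, par j U z w ∈ G)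
    (hunit : ∀ j (U : CfgY 𝔸 (f j).toKIdx), GVal G (f j).toKIdx U → IsUnit (deltaPrimeAY (f j).toKIdx (par j) U))
    (dB : ℕ) (M₂ : ℝ) (hM₂ : 0 ≤ M₂) (hrepr : ∀ (v : 𝔸) (j : ι), |b.repr v j| ≤ M₂ * ‖v‖)
    (Cq : ℝ) (hCq : 0 ≤ Cq) (hC37 : ∀ j β' U a, C37 j β' U a → GVal G (f j).toKIdx U ∧ CplxLettersY G (f j) (par j) (ιB j) Cq β' U a)
    (cR : ℝ) (hcR : 0 < cR) (wBf : ℝ → ℝ → ℝ) (hwBf : ∀ B δ : ℝ, 0 ≤ B → 0 < δ → 0 < wBf B δ) (wδf : ℝ → ℝ) (hwδf : ∀ δ : ℝ, 0 < δ → 0 < wδf δ)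
    (MInv aInv aW : ℝ) (hMInv : 0 < MInv) (haInv : 0 < aInv) (haW : 0 < aW)
    (hread : ∀ j, Read342Y G (f j) (par j) b (ιB j) (C37 j) (C38 j) (KC j) c35 cR MInv aInv 0 True)
    (hwrite : ∀ j, Write342Y G (f j) (par j) b (ιB j) (C37 j) (C38 j) (KC j) wBf wδf aW 0 True) :
    GpFrame₂ c35 (fun j => geo9Y (f j)) (fun j => (codingYx G (f j) (C37 j) (C38 j)).bg) KC b (Fin (d + 1)) (fun j => SiteY (f j).toKIdx) where
  dB := dB
  Cq := Cq
  a₀ := 1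
  d₀ := 2 * ((d : ℝ) + 1)
  M₂ := M₂
  Λf := fun _ _ => ((ℓ : ℝ) + 1) ^ 4
  cR := cR
  wB := wBf
  wδ := wδf
  MInv := MInv
  aInv := aInv
  aW := aW
  δcap := 1
  M261 := Classical.choose (Classical.choose_spec (exists_d261 (d := d) (ℓ := ℓ) (hd := hd) (hL := hL) (b₀ := b₀) (b₁ := b₁) (Mstar := Mstar)))
  MST := fun δ => 4 * Real.log ((ℓ : ℝ) + 1) / (9 / 5000 * δ)
  d261 := Classical.choose (exists_d261 (d := d) (ℓ := ℓ) (hd := hd) (hL := hL) (b₀ := b₀) (b₁ := b₁) (Mstar := Mstar))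
  Cq_nonneg := hCq
  a₀_nonneg := zero_le_one
  M₂_nonneg := hM₂
  Λf_one_le := fun _ _ _ _ => one_le_pow₀ (by have : (0 : ℝ) ≤ ℓ := Nat.cast_nonneg _; linarith)
  cR_pos := hcR
  wB_pos := hwBf
  wδ_pos := hwδf
  MInv_pos := hMInv
  aInv_pos := haInv
  aW_pos := haW
  δcap_pos := one_pos
  hrepr := hrepr
  T := fun j => shiftY (f j).toKIdx
  blk := fun j => blkC (f j).toKIdx (ιB j)
  Rr := fun _ => 0
  Hp := fun _ => True
  coord := fun j => coordC G (f j).toKIdx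
  kQ := fun j => kQC G (f j).toKIdx (par j)
  sQ := fun j => sQC G (f j).toKIdx (par j)
  w := fun j => wC (f j).toKIdx
  cfun := fun j => cfunC (f j).toKIdx
  expA := fun j => expAC (f j).toKIdx
  kF := fun j => kFC (f j).toKIdx (par j)
  sF := fun j => sFC (f j).toKIdx (par j)
  Δp := fun j => ΔpC (f j).toKIdx (par j) b
  Gop := fun j => GopC (f j).toKIdx (par j) b
  Lap := fun j => LapC (f j).toKIdx b
  dist_nonneg := fun j => geo9Y_dist_nonneg (f j)
  triangle := fun j => fun a bb c => geo9Y_dist_triangle (f j) a bb c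
  dist_self := fun j => geo9Y_dist_self (f j)
  dist_comm := fun j => geo9Y_dist_comm (f j)
  len_pos := fun j => geo9Y_len_pos (f j)
  eta_le_len := fun j y => by
    show (geo9Y (f j)).eta ≤ (geo9Y (f j)).L ^ (geo9Y (f j)).scale y * (geo9Y (f j)).eta
    exact le_mul_of_one_le_left (geo9K_eta_pos (f j).toKIdx).le (one_le_pow₀ (geo9K_one_le_L (f j).toKIdx))
  eta_pos := fun j => geo9K_eta_pos (f j).toKIdx
  h261 := fun j δ α hδ _ hα hα1 hM =>
    Classical.choose_spec (Classical.choose_spec (exists_d261 (d := d) (ℓ := ℓ) (hd := hd) (hL := hL) (b₀ := b₀) (b₁ := b₁) (Mstar := Mstar)))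
      (f j) δ α hδ hα hα1.le hM
  hST := fun j δ α hδ _ hα hM => by
    have hκlo : 0 < 9 / 5000 * δ := by positivity
    have hκ : 9 / 5000 * δ ≤ α * δ := mul_le_mul_of_nonneg_right hα hδ.le
    exact scaleTransfer6_window_geo9Y hκlo (f j) hκ hM
  unitary := fun j c m z => coordC_unitary G (f j).toKIdx hG1 c m z
  stencilB := fun j μ z => stencilB_blkC (f j).toKIdx (ιB j) (hι j) μ z
  stencilF := fun j μ z => stencilF_blkC (f j).toKIdx (ιB j) (hι j) μ z
  stencil0 := fun j y => stencil0_geo9K (f j).toKIdx y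
  w_nonneg := fun j c y => wC_nonneg (f j).toKIdx c y
  card_w := fun j c y => card_blkC_mul_wC_le (f j).toKIdx (ιB j) (instD := instDS (f j)) (hι j) c y
  hkQ := fun j c y z _ => kQC_norm_le G (f j).toKIdx (par j) hG1 (hpar j) c y z
  hsQ := fun j c z => sQC_norm_le G (f j).toKIdx (par j) hG1 (hpar j) c z
  hcfun := fun j y => cfunC_abs_le (f j).toKIdx y
  gop_eq := fun j c D X hD hDX hXD => gopC_eq (f j).toKIdx (par j) b c D X hD hDX hXD
  reg_inv := fun j α₀ c _ _ _ hreg => by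
    obtain ⟨U, rfl, hU⟩ := (codingYx G (f j) (C37 j) (C38 j)).exists_of_bg_Reg335 hreg
    exact ΔpC_mul_GopC (f j).toKIdx (par j) b (.base U) (hunit j U hU.1.1)
  cplx := fun j α₁ c c' _ h37 => by
    obtain ⟨U, a, rfl, rfl, hC⟩ := (codingYx G (f j) (C37 j) (C38 j)).exists_of_bg_Cplx337 h37
    exact (hC37 j α₁ U a hC).2
  mul_law := fun j α₁ c c' _ h37 => by
    obtain ⟨U, a, rfl, rfl, hC⟩ := (codingYx G (f j) (C37 j) (C38 j)).exists_of_bg_Cplx337 h37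
    exact ΔpC_mul_law G (f j).toKIdx (par j) b (ιB j) (instD := instDS (f j)) (hι j) (hC37 j α₁ U a hC).1 a
  read342 := fun j α₀ c B₀ δ hM hα₀ hMa hreg hB₀ hδ hE => by
    obtain ⟨U, rfl, hU⟩ := (codingYx G (f j) (C37 j) (C38 j)).exists_of_bg_Reg335 hreg
    exact hread j α₀ U B₀ δ hM hα₀ hMa hU hB₀ hδ hE
  write342 := fun j c c' α₁ B δ hα₁ hα₁W h37 hB hδ hG hDG hGD hLG => by
    obtain ⟨U, a, rfl, rfl, hC⟩ := (codingYx G (f j) (C37 j) (C38 j)).exists_of_bg_Cplx337 h37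
    exact hwrite j U a α₁ B δ hα₁ hα₁W hC hB hδ hG hDG hGD hLG

end RootFrame

/-! ## §2 ★ `hin` on a subfamily -/

section Hin

variable {J : Type} (f : J → MemberY d ℓ hd hL b₀ b₁ Mstar) [∀ x : MemberY d ℓ hd hL b₀ b₁ Mstar, Fintype (geo9Y x).Site]
  (G : Subgroup 𝔸ˣ) (par : ∀ j : J, SiteParY 𝔸 (f j).toKIdx) {ι : Type} [Fintype ι] (b : Module.Basis ι ℝ 𝔸)
  (ιB : ∀ j : J, BlkY (f j).toKIdx → IBondY (f j).toKIdx)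
  (C37 C38 : ∀ j : J, ℝ → CfgY 𝔸 (f j).toKIdx → AfldY 𝔸 (f j).toKIdx → Prop)

/-- ★ **THE HYPOTHESIS `hin` OF `sectBStepPrinted_of_family` ON A SUBFAMILY**, for `Gp₁ := KSC` and `Gp₂ :=` the record's `G′` read along the decoding:
M-threshold `max ML (2(d+1)+1)` (neighbourhood count of the member type, uniform), cap `1`, constants `(c_in(δ₀)·max B₀ 0, δ₀, B_β, B_ε, B_εβ, B₁, δ₁)` —
`B9SectBGpTransferInY.thms_KSC_base_of_pullK` at the members `f j`. [cite: Balaban1985BackgroundPropagators, Thms 3.1–3.3 (3.42)–(3.48) pp.397–399, (3.35) p.396, p.403 l.1–9; Balaban1984PropagatorsII, Lemma 2.1 (2.61) p.234] -/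
theorem hin_KSC_on (hι : ∀ (j : J) (s : BlkY (f j).toKIdx), β (f j).toKIdx.hN (f j).toKIdx.D (f j).toKIdx.hk (ιB j s) = s)
    (hG1 : ∀ u : 𝔸ˣ, u ∈ G → ‖(u : 𝔸)‖ ≤ 1) {M₂ : ℝ} (hM₂ : 0 ≤ M₂) (hrepr : ∀ (v : 𝔸) (j : ι), |b.repr v j| ≤ M₂ * ‖v‖) (c35 : ℝ) (dC : ℕ)
    (GA : ∀ j : J, B9.KernelFamily (geo9Y (f j)) (codingYx G (f j) (C37 j) (C38 j)).bg)
    (Cinv : ∀ j : J, B9.SiteKernel (geo9Y (f j)) (codingYx G (f j) (C37 j) (C38 j)).bg) :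
    ∀ (B₀ δ₀ : ℝ) (Bβ Bε : ℝ → ℝ) (Bεβ : ℝ → ℝ → ℝ) (B₁ δ₁ : ℝ),
      ∃ (Mi ai B₀' δ₀' : ℝ) (Bβ' Bε' : ℝ → ℝ) (Bεβ' : ℝ → ℝ → ℝ) (B₁' δ₁' : ℝ), 0 < ai ∧
        ∀ j : J, Mi ≤ (geo9Y (f j)).M → ∀ α₀ : ℝ, 0 < α₀ → (geo9Y (f j)).M * α₀ ≤ ai →
          ∀ c : (codingYx G (f j) (C37 j) (C38 j)).bg.Cfg, (codingYx G (f j) (C37 j) (C38 j)).bg.Reg335 c35 α₀ c →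
          B9.Thms31to33IneqAt dC (pullK (codingYx G (f j) (C37 j) (C38 j))
              (kernelFamilyS (f j).toKIdx (bg9Y 𝔸 G (f j)) (fun U => U) (GpY (f j).toKIdx (par j)) (par j))) (GA j) (Cinv j) B₀ δ₀ Bβ Bε Bεβ B₁ δ₁ c →
          B9.Thms31to33IneqAt dC (KSC G (f j) (par j) (C37 j) (C38 j)) (GA j) (Cinv j) B₀' δ₀' Bβ' Bε' Bεβ' B₁' δ₁' c := by
  intro B₀ δ₀ Bβ Bε Bεβ B₁ δ₁
  obtain ⟨ML, mN, hcnt⟩ := exists_card_nbr_geo9Y_le_of_M (d := d) (ℓ := ℓ) (hd := hd) (hL := hL) (b₀ := b₀) (b₁ := b₁) (2 * ((d : ℝ) + 1))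
  refine ⟨max ML (2 * ((d : ℝ) + 1) + 1), 1,
    (((ℓ + 1 : ℕ) : ℝ) * Real.exp (|δ₀| * (2 * ((d : ℝ) + 1))) + ((mN : ℝ) * (M₂ * ∑ j, ‖b j‖) * Real.exp (|δ₀| * (2 * ((d : ℝ) + 1))) + 1))
      * max B₀ 0, δ₀, Bβ, Bε, Bεβ, B₁, δ₁, one_pos, fun j hM α₀ _ _ c hreg hT => ?_⟩
  obtain ⟨U, rfl, hU335⟩ := (codingYx G (f j) (C37 j) (C38 j)).exists_of_bg_Reg335 hreg
  have hU : GVal G (f j).toKIdx U := hU335.1.1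
  have hM2 : 2 * ((d : ℝ) + 1) < (geo9Y (f j)).M := by
    have := le_trans (le_max_right _ _) hM
    linarith
  have hML : ML ≤ (geo9Y (f j)).M := le_trans (le_max_left _ _) hM
  exact thms_KSC_base_of_pullK G (f j) (par j) b (ιB j) (C37 j) (C38 j) (hι j) hG1 hU hM₂ hrepr hM2 (fun a => hcnt Mstar (f j) hML a) dC (GA j)
    (Cinv j) hT

end Hin

/-! ## §3 ★ `hconv` and `hout` on a subfamily -/

section Hout

variable [FiniteDimensional ℝ 𝔸] {J : Type} (f : J → MemberY d ℓ hd hL b₀ b₁ Mstar) [∀ x : MemberY d ℓ hd hL b₀ b₁ Mstar, Fintype (geo9Y x).Site]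
  (G : Subgroup 𝔸ˣ) (par : ∀ j : J, SiteParY 𝔸 (f j).toKIdx) {ι : Type} [Fintype ι] (b : Module.Basis ι ℝ 𝔸)
  (ιB : ∀ j : J, BlkY (f j).toKIdx → IBondY (f j).toKIdx)
  (C37 C38 : ∀ j : J, ℝ → CfgY 𝔸 (f j).toKIdx → AfldY 𝔸 (f j).toKIdx → Prop)

/-- ★ **`hconv` ON A SUBFAMILY**: M-threshold `max (M261 δ₀) (16 log(ℓ+1)∕δ₀)`, a constant `B″ ≧ 0` uniform in the member — `B9SectBGpTransferConvY.hconv_at` at the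
members `f j`. [cite: Balaban1985BackgroundPropagators, p.403 l.1–9, (3.70) p.404, (3.74) p.405, (3.42) p.397; Balaban1984PropagatorsII, Lemma 2.1 (2.59)–(2.61) pp.233–234] -/
theorem hconv_KSC_on (hG1 : ∀ u : 𝔸ˣ, u ∈ G → ‖(u : 𝔸)‖ ≤ 1) {M₂ : ℝ} (hM₂ : 0 ≤ M₂) (hrepr : ∀ (v : 𝔸) (j : ι), |b.repr v j| ≤ M₂ * ‖v‖)
    (hι : ∀ (j : J) (s : BlkY (f j).toKIdx), β (f j).toKIdx.hN (f j).toKIdx.D (f j).toKIdx.hk (ιB j s) = s)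
    {Cq : ℝ} (hC37 : ∀ j β' U a, C37 j β' U a → GVal G (f j).toKIdx U ∧ CplxLettersY G (f j) (par j) (ιB j) Cq β' U a) :
    ∀ (B₀ δ₀ : ℝ), 0 ≤ B₀ → 0 < δ₀ → ∃ (Mo B'' : ℝ), 0 ≤ B'' ∧
      ∀ j : J, Mo ≤ (geo9Y (f j)).M → ∀ (U : CfgY 𝔸 (f j).toKIdx) (a : AfldY 𝔸 (f j).toKIdx) (α₁ : ℝ), α₁ ≤ 1 / 4 → C37 j α₁ U a →
        EBlock (KSC G (f j) (par j) (C37 j) (C38 j)) B₀ δ₀ (.prod U a) →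
        EBlock (kernelFamilyS (f j).toKIdx (bg9Y 𝔸 G (f j)) (fun U => U) (GpY (f j).toKIdx (par j)) (par j)) B'' (δ₀ / 2)
          (mulY (f j).toKIdx (fluct (kGeo (f j).toKIdx).eta a) U) := by
  obtain ⟨d261, M261, h261f⟩ := exists_d261 (d := d) (ℓ := ℓ) (hd := hd) (hL := hL) (b₀ := b₀) (b₁ := b₁) (Mstar := Mstar)
  intro B₀ δ₀ hB₀ hδ₀
  have hκlo : 0 < 1 / 4 * δ₀ := by positivity
  refine ⟨max (M261 δ₀) (4 * Real.log ((ℓ : ℝ) + 1) / (1 / 4 * δ₀)), ?_, ?_, ?_⟩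
  pick_goal 3
  · intro j hM U a α₁ hα₁c hC hE
    have hM1 : M261 δ₀ ≤ (geo9Y (f j)).M := le_trans (le_max_left _ _) hM
    have hM2 : 4 * Real.log ((ℓ : ℝ) + 1) / (1 / 4 * δ₀) ≤ (geo9Y (f j)).M := le_trans (le_max_right _ _) hM
    have h261 := h261f (f j) δ₀ (1 / 4) hδ₀ (by norm_num) (by norm_num) hM1
    have hST := scaleTransfer6_window_geo9Y hκlo (f j) (δ := δ₀) (α := 1 / 4) le_rfl hM2
    exact hconv_at G (f j) (par j) b (ιB j) (C37 j) (C38 j) (hι j) hG1 hM₂ hrepr (hC37 j) hδ₀ h261 (Λ := ((ℓ : ℝ) + 1) ^ 4) (by positivity)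
      hST.1 hST.2.1 hST.2.2.1 hB₀ hα₁c hC hE
  · have hSb : 0 ≤ ∑ j, ‖b j‖ := Finset.sum_nonneg fun j _ => norm_nonneg _
    have hc₁ : 0 ≤ B6.c1 (d261 δ₀) δ₀ (1 / 4) := B6RandomWalk.c1_nonneg _ _ _
    have hcard : (0 : ℝ) ≤ Fintype.card (Fin (d + 1)) := Nat.cast_nonneg _
    have hΛ : (0 : ℝ) ≤ ((ℓ : ℝ) + 1) ^ 4 := by positivity
    have hk : 0 ≤ kappa385 (M₂ * (∑ j, ‖b j‖) * B₀)
        ((((2 + 8 * (1 : ℝ) ^ 2 * (1 / 4)) * Fintype.card (Fin (d + 1)) + 2 * Fintype.card (Fin (d + 1)) * 2) * M₂ * (∑ j, ‖b j‖) *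
          Real.exp (δ₀ * (2 * ((d : ℝ) + 1))))) 0 0 (((ℓ : ℝ) + 1) ^ 4) (B6.c1 (d261 δ₀) δ₀ (1 / 4)) :=
      kappa385_nonneg (by positivity) (by positivity) le_rfl le_rfl hΛ hc₁
    positivity

/-- ★ **THE HYPOTHESIS `hout` OF `sectBStepFamilyTransfer.sectBStepPrinted_of_family` ON A SUBFAMILY** (`hconv_KSC_on` ∘ `thms_pullK_prod_of_KSC`): caps
`ao = 1`, `a′ = min a (1/4)`, output constants `(max B₀ B″, min δ₀ (δ₀/2), B_β, B_ε, B_εβ, B₁, δ₁)`; the shared `GA` has nonnegative Hölder ∕ (3.44) ∕ (3.45)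
members. [cite: Balaban1985BackgroundPropagators, Thm 3.4 p.400, p.403 l.1–9, (3.35)–(3.37) p.396, (3.42)–(3.48) pp.397–399] -/
theorem hout_KSC_on (hG1 : ∀ u : 𝔸ˣ, u ∈ G → ‖(u : 𝔸)‖ ≤ 1) {M₂ : ℝ} (hM₂ : 0 ≤ M₂) (hrepr : ∀ (v : 𝔸) (j : ι), |b.repr v j| ≤ M₂ * ‖v‖)
    (hι : ∀ (j : J) (s : BlkY (f j).toKIdx), β (f j).toKIdx.hN (f j).toKIdx.D (f j).toKIdx.hk (ιB j s) = s)
    {Cq : ℝ} (hC37 : ∀ j β' U a, C37 j β' U a → GVal G (f j).toKIdx U ∧ CplxLettersY G (f j) (par j) (ιB j) Cq β' U a) (c35 : ℝ) (dC : ℕ)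
    (GA : ∀ j : J, B9.KernelFamily (geo9Y (f j)) (codingYx G (f j) (C37 j) (C38 j)).bg)
    (Cinv : ∀ j : J, B9.SiteKernel (geo9Y (f j)) (codingYx G (f j) (C37 j) (C38 j)).bg)
    (hGA : ∀ (j : J) (c : (codingYx G (f j) (C37 j) (C38 j)).bg.Cfg),
      (∀ lam β' ζ, 0 ≤ (GA j).h1 c lam β' ζ) ∧ (∀ lam y, 0 ≤ (GA j).e4 c lam y) ∧ (∀ lam β' ζ, 0 ≤ (GA j).h2 c lam β' ζ)) :
    ∀ (B₀ δ₀ : ℝ) (Bβ Bε : ℝ → ℝ) (Bεβ : ℝ → ℝ → ℝ) (B₁ δ₁ : ℝ) (acap : ℝ), 0 < B₀ → 0 < δ₀ → 0 < B₁ → 0 < δ₁ → 0 < acap →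
      ∃ (Mo ao a' B₀' δ₀' : ℝ) (Bβ' Bε' : ℝ → ℝ) (Bεβ' : ℝ → ℝ → ℝ) (B₁' δ₁' : ℝ),
        0 < ao ∧ 0 < a' ∧ a' ≤ acap ∧ 0 < B₀' ∧ 0 < δ₀' ∧ 0 < B₁' ∧ 0 < δ₁' ∧
        ∀ j : J, Mo ≤ (geo9Y (f j)).M → ∀ α₀ : ℝ, 0 < α₀ → (geo9Y (f j)).M * α₀ ≤ ao →
          ∀ c : (codingYx G (f j) (C37 j) (C38 j)).bg.Cfg, (codingYx G (f j) (C37 j) (C38 j)).bg.Reg335 c35 α₀ c →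
          ∀ α₁ : ℝ, 0 < α₁ → α₁ ≤ a' → ∀ c' : (codingYx G (f j) (C37 j) (C38 j)).bg.Cfg, (codingYx G (f j) (C37 j) (C38 j)).bg.Cplx337 α₁ c c' →
          B9.Thms31to33IneqAt dC (KSC G (f j) (par j) (C37 j) (C38 j)) (GA j) (Cinv j) B₀ δ₀ Bβ Bε Bεβ B₁ δ₁
              ((codingYx G (f j) (C37 j) (C38 j)).bg.mul c' c) →
          B9.Thms31to33IneqAt dC (pullK (codingYx G (f j) (C37 j) (C38 j))
              (kernelFamilyS (f j).toKIdx (bg9Y 𝔸 G (f j)) (fun U => U) (GpY (f j).toKIdx (par j)) (par j))) (GA j) (Cinv j)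
              B₀' δ₀' Bβ' Bε' Bεβ' B₁' δ₁' ((codingYx G (f j) (C37 j) (C38 j)).bg.mul c' c) := by
  intro B₀ δ₀ Bβ Bε Bεβ B₁ δ₁ acap hB₀ hδ₀ hB₁ hδ₁ hacap
  obtain ⟨Mo, B'', hB'', H⟩ := hconv_KSC_on f G par b ιB C37 C38 hG1 hM₂ hrepr hι hC37 B₀ δ₀ hB₀.le hδ₀
  refine ⟨Mo, 1, min acap (1 / 4), max B₀ B'', min δ₀ (δ₀ / 2), Bβ, Bε, Bεβ, B₁, δ₁, one_pos, lt_min hacap (by norm_num), min_le_left _ _,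
    lt_max_of_lt_left hB₀, lt_min hδ₀ (by linarith), hB₁, hδ₁, fun j hM α₀ _ _ c _ α₁ _ hα₁a c' h37 hT => ?_⟩
  obtain ⟨U, a, rfl, rfl, hC⟩ := (codingYx G (f j) (C37 j) (C38 j)).exists_of_bg_Cplx337 h37
  have hα₁c : α₁ ≤ 1 / 4 := le_trans hα₁a (min_le_right _ _)
  have hE : EBlock (KSC G (f j) (par j) (C37 j) (C38 j)) B₀ δ₀ (.prod U a) := hT.1.1.1
  exact thms_pullK_prod_of_KSC G (f j) (par j) (C37 j) (C38 j) dC (GA j) (Cinv j) (hGA j _).1 (hGA j _).2.1 (hGA j _).2.2 hB₀.le hT hB''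
    (H j hM U a α₁ hα₁c hC hE)

/-! ## §4 ★★ The composed transfer on a subfamily -/

/-- ★★ **THE CODED-CARRIER CHAIN, COMPOSED, ON A SUBFAMILY**: let `f : J → MemberY …` carry sections `ιB j` of `β`, a unit-norm structure group `G` (`hG1`),
transporters `par`, a real basis `b` with coordinate constant `M₂`, coded classes `C37 j` implying «`U` `G`-valued and `CplxLettersY`» (`hC37`), record
families `GA`, `Cinv` (Hölder ∕ (3.44) ∕ (3.45) members of `GA` nonnegative — every reading by suprema) and analyticity predicates `IsAnK` (coded side),
`IsAn` (record side) with the transport `hAn`, and the class implication `hclass` (record's (3.37) at `α₁ ≦ αcap` ⇒ coded class at `r·α₁`, above `Mc`).  IF the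
Sect.-B step holds for the augmented coded readings `(KSC, pullK GA, pullS Cinv, IsAnK)` over the coded carriers on `J` (the letters-level frames' output),
THEN the Sect.-B step holds FOR THE RECORD — `G′` read by `kernelFamilyS (GpY par) par`, `GA`, `Cinv`, `IsAn` over `bg9Y` — on `J`
(`sectBStepPrinted_of_coded ∘ sectBStepPrinted_of_family (hin_KSC_on) (hout_KSC_on) (hAn)`).
[cite: Balaban1985BackgroundPropagators, Thm 3.4 p.400, Sect. B pp.400–407, p.403 l.1–9, (3.35)–(3.37) p.396, p.399 (the family)] -/
theorem sectBStepPrinted_on_of_KSC (hG1 : ∀ u : 𝔸ˣ, u ∈ G → ‖(u : 𝔸)‖ ≤ 1) {M₂ : ℝ} (hM₂ : 0 ≤ M₂)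
    (hrepr : ∀ (v : 𝔸) (j : ι), |b.repr v j| ≤ M₂ * ‖v‖)
    (hι : ∀ (j : J) (s : BlkY (f j).toKIdx), β (f j).toKIdx.hN (f j).toKIdx.D (f j).toKIdx.hk (ιB j s) = s)
    {Cq : ℝ} (hC37 : ∀ j β' U a, C37 j β' U a → GVal G (f j).toKIdx U ∧ CplxLettersY G (f j) (par j) (ιB j) Cq β' U a) (c35 : ℝ) (dC : ℕ)
    (GA : ∀ j : J, B9.KernelFamily (geo9Y (f j)) (bg9Y 𝔸 G (f j))) (Cinv : ∀ j : J, B9.SiteKernel (geo9Y (f j)) (bg9Y 𝔸 G (f j)))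
    (hGA : ∀ (j : J) (U : (bg9Y 𝔸 G (f j)).Cfg),
      (∀ lam β' ζ, 0 ≤ (GA j).h1 U lam β' ζ) ∧ (∀ lam y, 0 ≤ (GA j).e4 U lam y) ∧ (∀ lam β' ζ, 0 ≤ (GA j).h2 U lam β' ζ))
    (IsAnK : ∀ j : J, B9.KernelFamily (geo9Y (f j)) (codingYx G (f j) (C37 j) (C38 j)).bg → (codingYx G (f j) (C37 j) (C38 j)).bg.Cfg → ℝ → Prop)
    (IsAn : ∀ j : J, B9.KernelFamily (geo9Y (f j)) (bg9Y 𝔸 G (f j)) → (bg9Y 𝔸 G (f j)).Cfg → ℝ → Prop)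
    {r αcap Mc ac : ℝ} (hr : 0 < r) (hcap : 0 < αcap) (hac : 0 < ac)
    (hAn : ∀ (j : J) (c : (codingYx G (f j) (C37 j) (C38 j)).bg.Cfg) (α : ℝ),
      (IsAnK j (KSC G (f j) (par j) (C37 j) (C38 j)) c α →
        pullAn (codingYx G (f j) (C37 j) (C38 j)) r (IsAn j)
          (pullK (codingYx G (f j) (C37 j) (C38 j)) (kernelFamilyS (f j).toKIdx (bg9Y 𝔸 G (f j)) (fun U => U) (GpY (f j).toKIdx (par j)) (par j))) c α) ∧
      (IsAnK j (pullK (codingYx G (f j) (C37 j) (C38 j)) (GA j)) c α →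
        pullAn (codingYx G (f j) (C37 j) (C38 j)) r (IsAn j) (pullK (codingYx G (f j) (C37 j) (C38 j)) (GA j)) c α))
    (hclass : ∀ (j : J) (α₀ α₁ : ℝ) (U U' : (bg9Y 𝔸 G (f j)).Cfg), Mc ≤ (geo9Y (f j)).M → 0 < α₀ → (geo9Y (f j)).M * α₀ ≤ ac →
      (bg9Y 𝔸 G (f j)).Reg335 c35 α₀ U → 0 < α₁ → α₁ ≤ αcap → (bg9Y 𝔸 G (f j)).Cplx337 α₁ U U' →
      ∃ a : (codingYx G (f j) (C37 j) (C38 j)).A,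
        (codingYx G (f j) (C37 j) (C38 j)).decA a = U' ∧ (codingYx G (f j) (C37 j) (C38 j)).C37 (r * α₁) U a)
    (h : B9.SectBStepPrinted dC c35 (fun j => geo9Y (f j)) (fun j => (codingYx G (f j) (C37 j) (C38 j)).bg)
      (fun j => KSC G (f j) (par j) (C37 j) (C38 j)) (fun j => pullK (codingYx G (f j) (C37 j) (C38 j)) (GA j))
      (fun j => pullS (codingYx G (f j) (C37 j) (C38 j)) (Cinv j)) IsAnK) :
    B9.SectBStepPrinted dC c35 (fun j => geo9Y (f j)) (fun j => bg9Y 𝔸 G (f j))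
      (fun j => kernelFamilyS (f j).toKIdx (bg9Y 𝔸 G (f j)) (fun U => U) (GpY (f j).toKIdx (par j)) (par j)) GA Cinv IsAn := by
  refine sectBStepPrinted_of_coded dC c35 (fun j => geo9Y (f j)) (fun j => bg9Y 𝔸 G (f j)) (fun j => codingYx G (f j) (C37 j) (C38 j))
    (fun j => kernelFamilyS (f j).toKIdx (bg9Y 𝔸 G (f j)) (fun U => U) (GpY (f j).toKIdx (par j)) (par j)) GA Cinv IsAn hr hcap hac hclass ?_
  exact sectBStepPrinted_of_family dC c35 (fun j => geo9Y (f j)) (fun j => (codingYx G (f j) (C37 j) (C38 j)).bg)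
    (fun j => KSC G (f j) (par j) (C37 j) (C38 j))
    (fun j => pullK (codingYx G (f j) (C37 j) (C38 j)) (kernelFamilyS (f j).toKIdx (bg9Y 𝔸 G (f j)) (fun U => U) (GpY (f j).toKIdx (par j)) (par j)))
    (fun j => pullK (codingYx G (f j) (C37 j) (C38 j)) (GA j)) (fun j => pullK (codingYx G (f j) (C37 j) (C38 j)) (GA j))
    (fun j => pullS (codingYx G (f j) (C37 j) (C38 j)) (Cinv j)) IsAnK
    (fun j => pullAn (codingYx G (f j) (C37 j) (C38 j)) r (IsAn j))
    (hin_KSC_on f G par b ιB C37 C38 hι hG1 hM₂ hrepr c35 dC _ _)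
    (hout_KSC_on f G par b ιB C37 C38 hG1 hM₂ hrepr hι hC37 c35 dC _ _ fun j c => hGA j _) hAn h

end Hout

/-! ## §5 Corner-free subfamilies: canonical sections, no binder left -/

section CornerFree

variable [NormOneClass 𝔸] [FiniteDimensional ℝ 𝔸] {J : Type} (f : J → MemberY d ℓ hd hL b₀ b₁ Mstar)
  (hf : ∀ j : J, Function.Surjective (β (f j).toKIdx.hN (f j).toKIdx.D (f j).toKIdx.hk))
  [∀ x : MemberY d ℓ hd hL b₀ b₁ Mstar, Fintype (geo9Y x).Site]
  [instDS : ∀ x : MemberY d ℓ hd hL b₀ b₁ Mstar, DecidableEq (geo9Y x).Site] [∀ x : MemberY d ℓ hd hL b₀ b₁ Mstar, Nonempty (geo9Y x).Site]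
  (c35 : ℝ) (G : Subgroup 𝔸ˣ) {ι : Type} [Fintype ι] [DecidableEq ι] (b : Module.Basis ι ℝ 𝔸)
  (C37 C38 : ∀ j : J, ℝ → CfgY 𝔸 (f j).toKIdx → AfldY 𝔸 (f j).toKIdx → Prop)
  (par : ∀ j : J, SiteParY 𝔸 (f j).toKIdx)

omit [NormOneClass 𝔸] [FiniteDimensional ℝ 𝔸] [∀ x : MemberY d ℓ hd hL b₀ b₁ Mstar, Fintype (geo9Y x).Site] instDS
  [∀ x : MemberY d ℓ hd hL b₀ b₁ Mstar, Nonempty (geo9Y x).Site] in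
/-- the canonical sections `Function.surjInv` of `β` along a subfamily of CORNER-FREE members (`β` onto at every `f j`; such members exist at every `k ≥ 2`,
`B9SectBCodedClassY.exists_memberY_surjective_beta`; the corner-free subtype `{x // Function.Surjective (β x.hN x.D x.hk)}` with `f := Subtype.val`,
`hf := (·.2)` is the universal instance). [cite: Balaban1984PropagatorsII, (2.45) p.231, (2.1)–(2.4) p.224, bookkeeping] -/
theorem surjInv_section (j : J) (s : BlkY (f j).toKIdx) :
    β (f j).toKIdx.hN (f j).toKIdx.D (f j).toKIdx.hk (Function.surjInv (hf j) s) = s :=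
  Function.surjInv_eq (hf j) s

/-- ★ **THE ROOT FRAME ON A CORNER-FREE SUBFAMILY, NO SECTION BINDER**: `gpFrame₂CodedOn f` with `ιB j := Function.surjInv (hf j)`.
[cite: Balaban1985BackgroundPropagators, Thm 3.4 p.400, Thm 3.1 (3.42) p.397, p.399 (the family); Balaban1984PropagatorsII, (2.45) p.231, Lemma 2.1 p.234] -/
noncomputable def gpFrame₂CodedCornerFree
    (KC : ∀ j : J, B9.KernelFamily (geo9Y (f j)) (codingYx G (f j) (C37 j) (C38 j)).bg)
    (hG1 : ∀ u : 𝔸ˣ, u ∈ G → ‖(u : 𝔸)‖ ≤ 1) (hpar : ∀ j (U : CfgY 𝔸 (f j).toKIdx), GVal G (f j).toKIdx U → ∀ z w, par j U z w ∈ G)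
    (hunit : ∀ j (U : CfgY 𝔸 (f j).toKIdx), GVal G (f j).toKIdx U → IsUnit (deltaPrimeAY (f j).toKIdx (par j) U))
    (dB : ℕ) (M₂ : ℝ) (hM₂ : 0 ≤ M₂) (hrepr : ∀ (v : 𝔸) (j : ι), |b.repr v j| ≤ M₂ * ‖v‖)
    (Cq : ℝ) (hCq : 0 ≤ Cq)
    (hC37 : ∀ j β' U a, C37 j β' U a → GVal G (f j).toKIdx U ∧ CplxLettersY G (f j) (par j) (fun s => Function.surjInv (hf j) s) Cq β' U a)
    (cR : ℝ) (hcR : 0 < cR) (wBf : ℝ → ℝ → ℝ) (hwBf : ∀ B δ : ℝ, 0 ≤ B → 0 < δ → 0 < wBf B δ) (wδf : ℝ → ℝ) (hwδf : ∀ δ : ℝ, 0 < δ → 0 < wδf δ)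
    (MInv aInv aW : ℝ) (hMInv : 0 < MInv) (haInv : 0 < aInv) (haW : 0 < aW)
    (hread : ∀ j, Read342Y G (f j) (par j) b (fun s => Function.surjInv (hf j) s) (C37 j) (C38 j) (KC j) c35 cR MInv aInv 0 True)
    (hwrite : ∀ j, Write342Y G (f j) (par j) b (fun s => Function.surjInv (hf j) s) (C37 j) (C38 j) (KC j) wBf wδf aW 0 True) :
    GpFrame₂ c35 (fun j => geo9Y (f j)) (fun j => (codingYx G (f j) (C37 j) (C38 j)).bg) KC b (Fin (d + 1)) (fun j => SiteY (f j).toKIdx) :=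
  gpFrame₂CodedOn f c35 G b C37 C38 par (fun j s => Function.surjInv (hf j) s) KC (fun j s => Function.surjInv_eq (hf j) s) hG1 hpar hunit dB M₂ hM₂
    hrepr Cq hCq hC37 cR hcR wBf hwBf wδf hwδf MInv aInv aW hMInv haInv haW hread hwrite

omit [NormOneClass 𝔸] instDS [∀ x : MemberY d ℓ hd hL b₀ b₁ Mstar, Nonempty (geo9Y x).Site] [DecidableEq ι] in
/-- ★★ **THE CODED-CARRIER CHAIN ON A CORNER-FREE SUBFAMILY, NO SECTION BINDER**: `sectBStepPrinted_on_of_KSC f` with the canonical sections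
`Function.surjInv (hf j)` — the Sect.-B step for the augmented coded readings over corner-free members gives the Sect.-B step for the record's families over
those members, given `hclass` and `hAn` there. [cite: Balaban1985BackgroundPropagators, Thm 3.4 p.400, Sect. B pp.400–407, p.403 l.1–9, (3.35)–(3.37) p.396, p.399; Balaban1984PropagatorsII, (2.45) p.231] -/
theorem sectBStepPrinted_cornerFree_of_KSC (hG1 : ∀ u : 𝔸ˣ, u ∈ G → ‖(u : 𝔸)‖ ≤ 1) {M₂ : ℝ} (hM₂ : 0 ≤ M₂)
    (hrepr : ∀ (v : 𝔸) (j : ι), |b.repr v j| ≤ M₂ * ‖v‖)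
    {Cq : ℝ} (hC37 : ∀ j β' U a, C37 j β' U a → GVal G (f j).toKIdx U ∧ CplxLettersY G (f j) (par j) (fun s => Function.surjInv (hf j) s) Cq β' U a)
    (dC : ℕ) (GA : ∀ j : J, B9.KernelFamily (geo9Y (f j)) (bg9Y 𝔸 G (f j))) (Cinv : ∀ j : J, B9.SiteKernel (geo9Y (f j)) (bg9Y 𝔸 G (f j)))
    (hGA : ∀ (j : J) (U : (bg9Y 𝔸 G (f j)).Cfg),
      (∀ lam β' ζ, 0 ≤ (GA j).h1 U lam β' ζ) ∧ (∀ lam y, 0 ≤ (GA j).e4 U lam y) ∧ (∀ lam β' ζ, 0 ≤ (GA j).h2 U lam β' ζ))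
    (IsAnK : ∀ j : J, B9.KernelFamily (geo9Y (f j)) (codingYx G (f j) (C37 j) (C38 j)).bg → (codingYx G (f j) (C37 j) (C38 j)).bg.Cfg → ℝ → Prop)
    (IsAn : ∀ j : J, B9.KernelFamily (geo9Y (f j)) (bg9Y 𝔸 G (f j)) → (bg9Y 𝔸 G (f j)).Cfg → ℝ → Prop)
    {r αcap Mc ac : ℝ} (hr : 0 < r) (hcap : 0 < αcap) (hac : 0 < ac)
    (hAn : ∀ (j : J) (c : (codingYx G (f j) (C37 j) (C38 j)).bg.Cfg) (α : ℝ),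
      (IsAnK j (KSC G (f j) (par j) (C37 j) (C38 j)) c α →
        pullAn (codingYx G (f j) (C37 j) (C38 j)) r (IsAn j)
          (pullK (codingYx G (f j) (C37 j) (C38 j)) (kernelFamilyS (f j).toKIdx (bg9Y 𝔸 G (f j)) (fun U => U) (GpY (f j).toKIdx (par j)) (par j))) c α) ∧
      (IsAnK j (pullK (codingYx G (f j) (C37 j) (C38 j)) (GA j)) c α →
        pullAn (codingYx G (f j) (C37 j) (C38 j)) r (IsAn j) (pullK (codingYx G (f j) (C37 j) (C38 j)) (GA j)) c α))
    (hclass : ∀ (j : J) (α₀ α₁ : ℝ) (U U' : (bg9Y 𝔸 G (f j)).Cfg), Mc ≤ (geo9Y (f j)).M → 0 < α₀ → (geo9Y (f j)).M * α₀ ≤ ac →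
      (bg9Y 𝔸 G (f j)).Reg335 c35 α₀ U → 0 < α₁ → α₁ ≤ αcap → (bg9Y 𝔸 G (f j)).Cplx337 α₁ U U' →
      ∃ a : (codingYx G (f j) (C37 j) (C38 j)).A,
        (codingYx G (f j) (C37 j) (C38 j)).decA a = U' ∧ (codingYx G (f j) (C37 j) (C38 j)).C37 (r * α₁) U a)
    (h : B9.SectBStepPrinted dC c35 (fun j => geo9Y (f j)) (fun j => (codingYx G (f j) (C37 j) (C38 j)).bg)
      (fun j => KSC G (f j) (par j) (C37 j) (C38 j)) (fun j => pullK (codingYx G (f j) (C37 j) (C38 j)) (GA j))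
      (fun j => pullS (codingYx G (f j) (C37 j) (C38 j)) (Cinv j)) IsAnK) :
    B9.SectBStepPrinted dC c35 (fun j => geo9Y (f j)) (fun j => bg9Y 𝔸 G (f j))
      (fun j => kernelFamilyS (f j).toKIdx (bg9Y 𝔸 G (f j)) (fun U => U) (GpY (f j).toKIdx (par j)) (par j)) GA Cinv IsAn :=
  sectBStepPrinted_on_of_KSC f G par b (fun j s => Function.surjInv (hf j) s) C37 C38 hG1 hM₂ hrepr (fun j s => Function.surjInv_eq (hf j) s) hC37 c35 dC
    GA Cinv hGA IsAnK IsAn hr hcap hac hAn hclass h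

end CornerFree

end Literature.MathematicalPhysics.QuantumFieldTheory.Balaban1983to89.B9SectBCodedChainOnSubfamily
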